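import Summits.QuantumFields.YangMills.Theorems.AllWindowsColdBoxBoxHighLineEdgeChartHyper
import Summits.QuantumFields.YangMills.Theorems.AllWindowsColdBoxBoxHighLineCubicVarianceOf

/-!
# T-S5.10 `CubicDecorrelation` from T-S5.7a `WilsonPlaquetteTaylor` — `E₀[c̃₀²·V₃²] ≤ C(1+log H)⁵·H⁴/β³` for `β ≥ H⁴`, `H ≥ 1`

Planner ym-idea-2 g18's `TaskS5Step2Wick.lean` (✓`…Step2Wick`), T-S5.10: the centred quadratic plaquette observable `c̃ = |ℓ_p|² − E₀|ℓ_p|²` decorrelates from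
the cubic vertex `V₃ = cubicVertex β H`.  Route (NO Feynman diagrams): with 7a, `V₃ = βΣ_p tripleForm + βΣ_p R_p`, `|R_p| ≤ (4+6C)(Σ_i‖v_i‖)⁵`
(✓`abs_odd_sub_tripleForm_le`), so pointwise

  `c̃²V₃² ≤ 2c̃²(βΣP)² + 2β²·#P·(4+6C)²4⁹·81·Σ_p Σ_i Σ_e Σ_c [e = edge_i(p)]·c̃²·(a_e^c)¹⁰`;

the right side is a POLYNOMIAL, and each piece is bounded by BONAMI–NELSON in the edge chart (✓`gaussAvg_sq_mul_sq_le_of_polyCert`, from w5 g22's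
✓Hypercontractivity): `E₀[c̃²(βΣP)²] ≤ 3⁵E₀[c̃²]E₀[(βΣP)²]`, `E₀[c̃²(a_e^c)¹⁰] ≤ 3⁷E₀[c̃²]E₀[(a_e^c)¹⁰]`, with `E₀[c̃²] ≤ C_V(1+log H)²/β²`
(✓`gaussAvg_centred_linCurvSq_sq_le`), `E₀[(βΣP)²] ≤ C_{TB}C²H⁴(1+log H)³/β` (✓`tripleBond_gaussAvg_le`), `E₀(a_e^c)¹⁰ ≤ E₀‖a_e‖¹⁰ ≤ C₁₀/β⁵`, `#P ≤ 4096H⁴`,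
`β ≥ H⁴`.  Main result: ★★`cubicDecorrelation_of : WilsonPlaquetteTaylor → CubicDecorrelation` (with `m = 5`).

Tree (✓EdgeChartHyper chain) + Mathlib; no definitions.  HONEST LABEL: T-S5.10 modulo 7a (w2's brick, OPEN); T-S5.13/S5, U5, ⟨24004⟩ ⟨24335⟩ ⟨24336⟩ remain OPEN; route
AllWindowsColdBox is DRAFT; no rung is proved; the Yang–Mills mass gap is NOT proved by this file.  Seat ym-line-sfw-p2 g77 (LEAD, cell ym-idea-1; Wick layer).
-/

set_option autoImplicit false

noncomputable section

open MeasureTheory Matrix Finset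
open scoped Kronecker Nat Matrix
open Literature.Probability.LatticeModels (Site)
open Literature.MathematicalPhysics.QuantumLattice (ZdPlaquette plaquettesTouching)
open Summit.QuantumFields.YangMills.Theorems.WeakCouplingRates (plaq12At)

namespace Summit.QuantumFields.YangMills.Theorems.AllWindowsColdBoxBoxHighLine

namespace EdgeChartGaussian

open LaplaceSandwich (flatten)

/-- Coordinates are dominated by norms: `(a_e^c)¹⁰ ≤ ‖a_e‖¹⁰`. -/
theorem coord_pow_ten_le_norm_pow_ten {H : ℕ} (a : LandauFree H → E3) (e : LandauFree H) (c : Fin 3) : a e c ^ 10 ≤ ‖a e‖ ^ 10 := by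
  have h : |a e c| ≤ ‖a e‖ := by
    have h := PiLp.norm_apply_le (a e) c
    rwa [Real.norm_eq_abs] at h
  calc a e c ^ 10 = |a e c| ^ 10 := by rw [← abs_of_nonneg (by positivity : (0 : ℝ) ≤ a e c ^ 10), abs_pow]
    _ ≤ ‖a e‖ ^ 10 := pow_le_pow_left₀ (abs_nonneg _) h 10

/-- A plaquette variable's tenth power is dominated by coordinate monomials: `‖v_i‖¹⁰ ≤ 81·Σ_e Σ_c [e = edge_i]·(a_e^c)¹⁰`. -/
theorem norm_plaqVar_pow_le_coordSum (H : ℕ) (x : Site 4) (μ ν i : Fin 4) (a : LandauFree H → E3) :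
    ‖plaqVar H x μ ν a i‖ ^ 10 ≤ 81 * ∑ e : LandauFree H, ∑ c : Fin 3,
      if (e.1.1 : Literature.MathematicalPhysics.QuantumLattice.ZdEdge 4) = plaqEdge x μ ν i then a e c ^ 10 else 0 := by
  refine (norm_plaqVar_pow_le_sum H x μ ν i a).trans ?_
  rw [Finset.mul_sum]
  refine Finset.sum_le_sum fun e _ => ?_
  split_ifs with h
  · exact norm_pow_ten_le (a e)
  · simp

/-- ★★ **T-S5.10 from T-S5.7a**: `WilsonPlaquetteTaylor → CubicDecorrelation` (with `m = 5`). -/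
theorem cubicDecorrelation_of (h7a : WilsonPlaquetteTaylor) : CubicDecorrelation := by
  classical
  obtain ⟨C7, h7⟩ := h7a
  choose Tf hTf h7f using h7
  let T : ZdPlaquette 4 → Fin 4 → Fin 4 → Fin 4 → ℝ := fun p => Tf p.2.1.1 p.2.1.2 (ne_of_lt p.2.2)
  have hT : ∀ p i j k, |T p i j k| ≤ C7 := fun p => hTf _ _ _
  have hC7 : 0 ≤ C7 := (abs_nonneg _).trans (hT (((0 : Site 4), ⟨(0, 1), by decide⟩) : ZdPlaquette 4) 0 0 0)
  obtain ⟨CTB, hTB⟩ := tripleBond_gaussAvg_le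
  obtain ⟨C10, hC10, h10⟩ := gaussAvg_norm_pow_ten_le
  obtain ⟨CV, hCV, hV⟩ := gaussAvg_centred_linCurvSq_sq_le
  set C8 : ℝ := 4 + 6 * C7 with hC8
  set KB : ℝ := 2 * 81 * 4 * 3 ^ 8 * (C8 ^ 2 * 4 ^ 9) * CV * C10 with hKB
  refine ⟨486 * CV * CTB * C7 ^ 2 + KB * 2 ^ 24, 5, fun H hH β hβH x => ?_⟩
  set PT := plaquettesTouching (Literature.MathematicalPhysics.QuantumFieldTheory.AxialGauge.boxEdges 4 (2 * H + 1)) with hPT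
  set p₀ := plaq12At x with hp₀
  have hH1 : (1 : ℝ) ≤ H := by exact_mod_cast hH
  have hβ1 : 1 ≤ β := (one_le_pow₀ hH1 : (1 : ℝ) ≤ (H : ℝ) ^ 4).trans hβH
  have hβ : 0 < β := by linarith
  set L := 1 + Real.log H with hL
  have hL1 : 1 ≤ L := by have := Real.log_nonneg hH1; rw [hL]; linarith
  obtain ⟨m, hm⟩ : ∃ m : ℝ, gaussAvg β H (linCurvSq H p₀) = m := ⟨_, rfl⟩
  rw [hm]
  -- the pieces
  let ct : (LandauFree H → E3) → ℝ := fun a => linCurvSq H p₀ a - m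
  let P : ZdPlaquette 4 → (LandauFree H → E3) → ℝ := fun p a => tripleForm (T p) (plaqVar H p.1 p.2.1.1 p.2.1.2 a)
  let R : ZdPlaquette 4 → (LandauFree H → E3) → ℝ := fun p a => chartPlaqCostOdd H p.1 p.2.1.1 p.2.1.2 a - P p a
  let D : ZdPlaquette 4 → Fin 4 → LandauFree H → Fin 3 → (LandauFree H → E3) → ℝ := fun p i e c a =>
    if (e.1.1 : Literature.MathematicalPhysics.QuantumLattice.ZdEdge 4) = plaqEdge p.1 p.2.1.1 p.2.1.2 i then a e c ^ 10 else 0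
  -- polynomial certificates
  have hct : ∃ Q : MvPolynomial (LandauFree H × Fin 3) ℝ, Q.totalDegree ≤ 2 ∧ ∀ a, ct a = MvPolynomial.eval (flatten (LandauFree H) a) Q :=
    polyCert_sub (polyCert_linCurvSq H p₀) (polyCert_const m 2)
  have hSP : ∃ Q : MvPolynomial (LandauFree H × Fin 3) ℝ, Q.totalDegree ≤ 3 ∧ ∀ a, β * ∑ p ∈ PT, P p a = MvPolynomial.eval (flatten (LandauFree H) a) Q :=
    polyCert_tripleFormSum H β PT T hT
  have hcoord5 : ∀ (e : LandauFree H) (c : Fin 3),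
      ∃ Q : MvPolynomial (LandauFree H × Fin 3) ℝ, Q.totalDegree ≤ 5 ∧ ∀ a : LandauFree H → E3, a e c ^ 5 = MvPolynomial.eval (flatten (LandauFree H) a) Q := by
    intro e c
    have h := polyCert_pow (polyCert_coord e c (le_refl 1)) 5
    simpa only [mul_one] using h
  -- the remainder bounds (as in 12a)
  have hR : ∀ p a, |R p a| ≤ C8 * (∑ i : Fin 4, ‖plaqVar H p.1 p.2.1.1 p.2.1.2 a i‖) ^ 5 := fun p a =>
    abs_odd_sub_tripleForm_le (hTf _ _ _) H p.1 p.2.1.1 p.2.1.2 (fun t a ht ht1 hv => (h7f _ _ _ H p.1 t a ht ht1 hv).2) a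
  have hR2 : ∀ p a, R p a ^ 2 ≤ C8 ^ 2 * 4 ^ 9 * 81 * ∑ i : Fin 4, ∑ e : LandauFree H, ∑ c : Fin 3, D p i e c a := by
    intro p a
    have h1 := hR p a
    have hj := pow_sum_le_card_mul_sum_pow (s := (Finset.univ : Finset (Fin 4))) (f := fun i => ‖plaqVar H p.1 p.2.1.1 p.2.1.2 a i‖)
      (fun i _ => norm_nonneg _) 9
    simp only [Finset.card_univ, Fintype.card_fin] at hj
    have hD : ∑ i : Fin 4, ‖plaqVar H p.1 p.2.1.1 p.2.1.2 a i‖ ^ 10 ≤ 81 * ∑ i : Fin 4, ∑ e : LandauFree H, ∑ c : Fin 3, D p i e c a := by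
      rw [Finset.mul_sum]
      exact Finset.sum_le_sum fun i _ => norm_plaqVar_pow_le_coordSum H p.1 p.2.1.1 p.2.1.2 i a
    have habs : R p a ^ 2 = |R p a| ^ 2 := (sq_abs _).symm
    have h5 : |R p a| ^ 2 ≤ (C8 * (∑ i : Fin 4, ‖plaqVar H p.1 p.2.1.1 p.2.1.2 a i‖) ^ 5) ^ 2 :=
      pow_le_pow_left₀ (abs_nonneg _) h1 2
    rw [habs]
    refine h5.trans ?_
    calc (C8 * (∑ i : Fin 4, ‖plaqVar H p.1 p.2.1.1 p.2.1.2 a i‖) ^ 5) ^ 2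
        = C8 ^ 2 * (∑ i : Fin 4, ‖plaqVar H p.1 p.2.1.1 p.2.1.2 a i‖) ^ 10 := by ring
      _ ≤ C8 ^ 2 * ((4 : ℝ) ^ 9 * ∑ i : Fin 4, ‖plaqVar H p.1 p.2.1.1 p.2.1.2 a i‖ ^ 10) := by
          refine mul_le_mul_of_nonneg_left ?_ (sq_nonneg _)
          exact_mod_cast hj
      _ ≤ C8 ^ 2 * ((4 : ℝ) ^ 9 * (81 * ∑ i : Fin 4, ∑ e : LandauFree H, ∑ c : Fin 3, D p i e c a)) :=
          mul_le_mul_of_nonneg_left (mul_le_mul_of_nonneg_left hD (by norm_num)) (sq_nonneg _)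
      _ = _ := by ring
  -- pointwise domination of `V₃²` and of `c̃²V₃²` by polynomials
  have hV2 : ∀ a : LandauFree H → E3, cubicVertex β H a ^ 2 ≤ 2 * (β * ∑ p ∈ PT, P p a) ^ 2 +
      2 * β ^ 2 * PT.card * (C8 ^ 2 * 4 ^ 9 * 81) * ∑ p ∈ PT, ∑ i : Fin 4, ∑ e : LandauFree H, ∑ c : Fin 3, D p i e c a := by
    intro a
    have hV : cubicVertex β H a = β * ∑ p ∈ PT, P p a + β * ∑ p ∈ PT, R p a := by
      unfold cubicVertex
      rw [← mul_add, ← Finset.sum_add_distrib]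
      congr 1
      exact Finset.sum_congr rfl fun p _ => by simp only [R, P]; ring
    rw [hV]
    have hsq : (β * ∑ p ∈ PT, P p a + β * ∑ p ∈ PT, R p a) ^ 2 ≤ 2 * (β * ∑ p ∈ PT, P p a) ^ 2 + 2 * (β * ∑ p ∈ PT, R p a) ^ 2 := by
      nlinarith [sq_nonneg (β * ∑ p ∈ PT, P p a - β * ∑ p ∈ PT, R p a)]
    refine hsq.trans (add_le_add le_rfl ?_)
    have hcs : (∑ p ∈ PT, R p a) ^ 2 ≤ PT.card * ∑ p ∈ PT, R p a ^ 2 := sq_sum_le_card_mul_sum_sq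
    have hsumR : ∑ p ∈ PT, R p a ^ 2 ≤ ∑ p ∈ PT, C8 ^ 2 * 4 ^ 9 * 81 * ∑ i : Fin 4, ∑ e : LandauFree H, ∑ c : Fin 3, D p i e c a :=
      Finset.sum_le_sum fun p _ => hR2 p a
    rw [← Finset.mul_sum] at hsumR
    calc 2 * (β * ∑ p ∈ PT, R p a) ^ 2 = 2 * β ^ 2 * (∑ p ∈ PT, R p a) ^ 2 := by ring
      _ ≤ 2 * β ^ 2 * (PT.card * ∑ p ∈ PT, R p a ^ 2) := mul_le_mul_of_nonneg_left hcs (by positivity)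
      _ ≤ 2 * β ^ 2 * (PT.card * (C8 ^ 2 * 4 ^ 9 * 81 * ∑ p ∈ PT, ∑ i : Fin 4, ∑ e : LandauFree H, ∑ c : Fin 3, D p i e c a)) :=
          mul_le_mul_of_nonneg_left (mul_le_mul_of_nonneg_left hsumR (Nat.cast_nonneg _)) (by positivity)
      _ = _ := by ring
  have hdom : ∀ a : LandauFree H → E3, (linCurvSq H p₀ a - m) ^ 2 * cubicVertex β H a ^ 2 ≤
      2 * (ct a ^ 2 * (β * ∑ p ∈ PT, P p a) ^ 2) +
        2 * β ^ 2 * PT.card * (C8 ^ 2 * 4 ^ 9 * 81) * (ct a ^ 2 * ∑ p ∈ PT, ∑ i : Fin 4, ∑ e : LandauFree H, ∑ c : Fin 3, D p i e c a) := by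
    intro a
    have hct0 : 0 ≤ ct a ^ 2 := sq_nonneg _
    have hmul := mul_le_mul_of_nonneg_left (hV2 a) hct0
    calc (linCurvSq H p₀ a - m) ^ 2 * cubicVertex β H a ^ 2 = ct a ^ 2 * cubicVertex β H a ^ 2 := rfl
      _ ≤ _ := hmul
      _ = _ := by ring
  -- integrability of the polynomial pieces
  have hI1 : Integrable (fun a : LandauFree H → E3 => ct a ^ 2 * (β * ∑ p ∈ PT, P p a) ^ 2 * gaussWeight β H a) := by
    have h := integrable_polyCert_mul_gaussWeight H hβ (polyCert_pow (polyCert_mul hct hSP) 2)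
    refine h.congr (Filter.Eventually.of_forall fun a => ?_)
    simp only [mul_pow]
  have hID : ∀ p i e c, Integrable (fun a : LandauFree H → E3 => ct a ^ 2 * D p i e c a * gaussWeight β H a) := by
    intro p i e c
    by_cases hcond : (e.1.1 : Literature.MathematicalPhysics.QuantumLattice.ZdEdge 4) = plaqEdge p.1 p.2.1.1 p.2.1.2 i
    · have h := integrable_polyCert_mul_gaussWeight H hβ (polyCert_mul (polyCert_pow hct 2) (polyCert_pow (polyCert_coord e c (le_refl 1)) 10))
      refine h.congr (Filter.Eventually.of_forall fun a => ?_)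
      simp only [D, if_pos hcond]
    · refine (integrable_zero _ _ _).congr (Filter.Eventually.of_forall fun a => ?_)
      simp only [D, if_neg hcond, mul_zero, zero_mul, Pi.zero_apply]
  have hIS : Integrable (fun a : LandauFree H → E3 =>
      (ct a ^ 2 * ∑ p ∈ PT, ∑ i : Fin 4, ∑ e : LandauFree H, ∑ c : Fin 3, D p i e c a) * gaussWeight β H a) := by
    have h := integrable_finsetSum PT fun p _ => integrable_finsetSum (Finset.univ : Finset (Fin 4)) fun i _ =>
      integrable_finsetSum (Finset.univ : Finset (LandauFree H)) fun e _ => integrable_finsetSum (Finset.univ : Finset (Fin 3)) fun c _ => hID p i e c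
    refine h.congr (Filter.Eventually.of_forall fun a => ?_)
    simp only [Finset.mul_sum, Finset.sum_mul]
  have hIG : Integrable (fun a : LandauFree H → E3 => (2 * (ct a ^ 2 * (β * ∑ p ∈ PT, P p a) ^ 2) +
      2 * β ^ 2 * PT.card * (C8 ^ 2 * 4 ^ 9 * 81) * (ct a ^ 2 * ∑ p ∈ PT, ∑ i : Fin 4, ∑ e : LandauFree H, ∑ c : Fin 3, D p i e c a)) *
        gaussWeight β H a) := by
    have h := (hI1.const_mul 2).add (hIS.const_mul (2 * β ^ 2 * PT.card * (C8 ^ 2 * 4 ^ 9 * 81)))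
    refine h.congr (Filter.Eventually.of_forall fun a => ?_)
    simp only [Pi.add_apply]
    ring
  -- Gaussian bounds of the pieces
  have hVc : gaussAvg β H (fun a => ct a ^ 2) ≤ CV * L ^ 2 / β ^ 2 := by
    have h := hV H hH β hβ p₀
    rw [hm] at h
    exact h
  have hTBv : gaussAvg β H (fun a => (β * ∑ p ∈ PT, P p a) ^ 2) ≤ CTB * C7 ^ 2 * (H : ℝ) ^ 4 * L ^ 3 / β := hTB H hH β hβ C7 T hT
  have hVc0 : 0 ≤ gaussAvg β H (fun a => ct a ^ 2) := gaussAvg_nonneg H hβ fun a => sq_nonneg _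
  have hA : gaussAvg β H (fun a => ct a ^ 2 * (β * ∑ p ∈ PT, P p a) ^ 2) ≤ 243 * (CV * L ^ 2 / β ^ 2) * (CTB * C7 ^ 2 * (H : ℝ) ^ 4 * L ^ 3 / β) := by
    have h := gaussAvg_sq_mul_sq_le_of_polyCert H hβ hct hSP
    refine h.trans ?_
    have h35 : ((3 : ℝ) ^ (2 + 3)) = 243 := by norm_num
    rw [h35]
    have hP0 : 0 ≤ gaussAvg β H (fun a => (β * ∑ p ∈ PT, P p a) ^ 2) := gaussAvg_nonneg H hβ fun a => sq_nonneg _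
    calc 243 * gaussAvg β H (fun a => ct a ^ 2) * gaussAvg β H (fun a => (β * ∑ p ∈ PT, P p a) ^ 2)
        ≤ 243 * (CV * L ^ 2 / β ^ 2) * gaussAvg β H (fun a => (β * ∑ p ∈ PT, P p a) ^ 2) :=
          mul_le_mul_of_nonneg_right (mul_le_mul_of_nonneg_left hVc (by norm_num)) hP0
      _ ≤ 243 * (CV * L ^ 2 / β ^ 2) * (CTB * C7 ^ 2 * (H : ℝ) ^ 4 * L ^ 3 / β) :=
          mul_le_mul_of_nonneg_left hTBv (by positivity)
  have hBterm : ∀ p i e c, gaussAvg β H (fun a => ct a ^ 2 * D p i e c a) ≤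
      if (e.1.1 : Literature.MathematicalPhysics.QuantumLattice.ZdEdge 4) = plaqEdge p.1 p.2.1.1 p.2.1.2 i then 3 ^ 7 * (CV * L ^ 2 / β ^ 2) * (C10 / β ^ 5) else 0 := by
    intro p i e c
    by_cases hcond : (e.1.1 : Literature.MathematicalPhysics.QuantumLattice.ZdEdge 4) = plaqEdge p.1 p.2.1.1 p.2.1.2 i
    · rw [if_pos hcond]
      have hfun : (fun a : LandauFree H → E3 => ct a ^ 2 * D p i e c a) = fun a => ct a ^ 2 * (a e c ^ 5) ^ 2 := by
        funext a; simp only [D, if_pos hcond]; ring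
      rw [hfun]
      have h := gaussAvg_sq_mul_sq_le_of_polyCert H hβ hct (hcoord5 e c)
      refine h.trans ?_
      have h37 : ((3 : ℝ) ^ (2 + 5)) = 3 ^ 7 := by norm_num
      rw [h37]
      have h10e : gaussAvg β H (fun a => (a e c ^ 5) ^ 2) ≤ C10 / β ^ 5 := by
        have hmono : gaussAvg β H (fun a => (a e c ^ 5) ^ 2) ≤ gaussAvg β H (fun a => ‖a e‖ ^ 10) := by
          refine gaussAvg_mono H hβ (fun a => ?_) ?_ (integrable_norm_pow_ten_mul_gaussWeight H hβ e)
          · rw [← pow_mul]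
            exact coord_pow_ten_le_norm_pow_ten a e c
          · have := integrable_coord_pow_mul_gaussWeight H hβ e c 10
            exact this.congr (Filter.Eventually.of_forall fun a => by simp only [← pow_mul])
        exact hmono.trans (h10 H hH β hβ e)
      have hG0 : 0 ≤ gaussAvg β H (fun a => (a e c ^ 5) ^ 2) := gaussAvg_nonneg H hβ fun a => sq_nonneg _
      calc (3 : ℝ) ^ 7 * gaussAvg β H (fun a => ct a ^ 2) * gaussAvg β H (fun a => (a e c ^ 5) ^ 2)
          ≤ 3 ^ 7 * (CV * L ^ 2 / β ^ 2) * gaussAvg β H (fun a => (a e c ^ 5) ^ 2) :=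
            mul_le_mul_of_nonneg_right (mul_le_mul_of_nonneg_left hVc (by norm_num)) hG0
        _ ≤ 3 ^ 7 * (CV * L ^ 2 / β ^ 2) * (C10 / β ^ 5) := mul_le_mul_of_nonneg_left h10e (by positivity)
    · rw [if_neg hcond]
      have hfun : (fun a : LandauFree H → E3 => ct a ^ 2 * D p i e c a) = fun a => 0 * ct a ^ 2 := by
        funext a; simp only [D, if_neg hcond]; ring
      rw [hfun, gaussAvg_const_mul, zero_mul]
  have hBsum : gaussAvg β H (fun a => ct a ^ 2 * ∑ p ∈ PT, ∑ i : Fin 4, ∑ e : LandauFree H, ∑ c : Fin 3, D p i e c a) ≤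
      4 * PT.card * (3 ^ 8 * (CV * L ^ 2 / β ^ 2) * (C10 / β ^ 5)) := by
    have hpush : (fun a : LandauFree H → E3 => ct a ^ 2 * ∑ p ∈ PT, ∑ i : Fin 4, ∑ e : LandauFree H, ∑ c : Fin 3, D p i e c a) =
        fun a => ∑ p ∈ PT, ∑ i : Fin 4, ∑ e : LandauFree H, ∑ c : Fin 3, ct a ^ 2 * D p i e c a := by
      funext a; simp only [Finset.mul_sum]
    rw [hpush]
    rw [gaussAvg_finset_sum _ _ _ _ fun p _ => ?_]
    · have hp : ∀ p ∈ PT, gaussAvg β H (fun a => ∑ i : Fin 4, ∑ e : LandauFree H, ∑ c : Fin 3, ct a ^ 2 * D p i e c a) ≤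
          4 * (3 ^ 8 * (CV * L ^ 2 / β ^ 2) * (C10 / β ^ 5)) := by
        intro p _
        rw [gaussAvg_finset_sum _ _ _ _ fun i _ => ?_]
        · have hi : ∀ i : Fin 4, gaussAvg β H (fun a => ∑ e : LandauFree H, ∑ c : Fin 3, ct a ^ 2 * D p i e c a) ≤
              3 ^ 8 * (CV * L ^ 2 / β ^ 2) * (C10 / β ^ 5) := by
            intro i
            rw [gaussAvg_finset_sum _ _ _ _ fun e _ => ?_]
            · have he : ∀ e : LandauFree H, gaussAvg β H (fun a => ∑ c : Fin 3, ct a ^ 2 * D p i e c a) ≤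
                  if (e.1.1 : Literature.MathematicalPhysics.QuantumLattice.ZdEdge 4) = plaqEdge p.1 p.2.1.1 p.2.1.2 i then
                    3 ^ 8 * (CV * L ^ 2 / β ^ 2) * (C10 / β ^ 5) else 0 := by
                intro e
                rw [gaussAvg_finset_sum _ _ _ _ fun c _ => hID p i e c]
                refine (Finset.sum_le_sum fun c _ => hBterm p i e c).trans ?_
                rw [Finset.sum_const, Finset.card_univ, Fintype.card_fin]
                split_ifs
                · simp only [nsmul_eq_mul]; exact le_of_eq (by ring)
                · simp
              refine (Finset.sum_le_sum fun e _ => he e).trans ?_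
              exact sum_indicator_edge_le H _ (by positivity)
            · have h := integrable_finsetSum (Finset.univ : Finset (Fin 3)) fun c _ => hID p i e c
              refine h.congr (Filter.Eventually.of_forall fun a => ?_)
              simp only [Finset.sum_mul]
          calc ∑ i : Fin 4, gaussAvg β H (fun a => ∑ e : LandauFree H, ∑ c : Fin 3, ct a ^ 2 * D p i e c a)
              ≤ ∑ _i : Fin 4, 3 ^ 8 * (CV * L ^ 2 / β ^ 2) * (C10 / β ^ 5) := Finset.sum_le_sum fun i _ => hi i
            _ = 4 * (3 ^ 8 * (CV * L ^ 2 / β ^ 2) * (C10 / β ^ 5)) := by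
                rw [Finset.sum_const, Finset.card_univ, Fintype.card_fin, nsmul_eq_mul]; norm_num
        · have h := integrable_finsetSum (Finset.univ : Finset (LandauFree H)) fun e _ =>
            integrable_finsetSum (Finset.univ : Finset (Fin 3)) fun c _ => hID p i e c
          refine h.congr (Filter.Eventually.of_forall fun a => ?_)
          simp only [Finset.sum_mul]
      calc ∑ p ∈ PT, gaussAvg β H (fun a => ∑ i : Fin 4, ∑ e : LandauFree H, ∑ c : Fin 3, ct a ^ 2 * D p i e c a)
          ≤ ∑ _p ∈ PT, 4 * (3 ^ 8 * (CV * L ^ 2 / β ^ 2) * (C10 / β ^ 5)) := Finset.sum_le_sum hp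
        _ = 4 * PT.card * (3 ^ 8 * (CV * L ^ 2 / β ^ 2) * (C10 / β ^ 5)) := by rw [Finset.sum_const, nsmul_eq_mul]; ring
    · have h := integrable_finsetSum (Finset.univ : Finset (Fin 4)) fun i _ => integrable_finsetSum (Finset.univ : Finset (LandauFree H)) fun e _ =>
        integrable_finsetSum (Finset.univ : Finset (Fin 3)) fun c _ => hID p i e c
      refine h.congr (Filter.Eventually.of_forall fun a => ?_)
      simp only [Finset.sum_mul]
  -- counting and `β ≥ H⁴`
  have hcard := card_plaquettesTouching_le H
  have hPTle : (PT.card : ℝ) ≤ 4096 * (H : ℝ) ^ 4 := by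
    have h1 : (2 * (H : ℝ) + 2) ≤ 4 * H := by linarith
    have hH4 : (2 * (H : ℝ) + 2) ^ 4 ≤ 256 * (H : ℝ) ^ 4 := by
      calc (2 * (H : ℝ) + 2) ^ 4 ≤ (4 * (H : ℝ)) ^ 4 := pow_le_pow_left₀ (by positivity) h1 4
        _ = 256 * (H : ℝ) ^ 4 := by ring
    exact hcard.trans (by linarith)
  have hPT2 : (PT.card : ℝ) ^ 2 ≤ 2 ^ 24 * (H : ℝ) ^ 8 := by
    calc (PT.card : ℝ) ^ 2 ≤ (4096 * (H : ℝ) ^ 4) ^ 2 := pow_le_pow_left₀ (Nat.cast_nonneg _) hPTle 2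
      _ = 2 ^ 24 * (H : ℝ) ^ 8 := by norm_num; ring
  have hH4β : (H : ℝ) ^ 4 ≤ β ^ 2 := hβH.trans (by nlinarith)
  have hβ0 : β ≠ 0 := hβ.ne'
  -- assemble
  have hmain : gaussAvg β H (fun a => (linCurvSq H p₀ a - m) ^ 2 * cubicVertex β H a ^ 2) ≤
      2 * (243 * (CV * L ^ 2 / β ^ 2) * (CTB * C7 ^ 2 * (H : ℝ) ^ 4 * L ^ 3 / β)) +
        2 * β ^ 2 * PT.card * (C8 ^ 2 * 4 ^ 9 * 81) * (4 * PT.card * (3 ^ 8 * (CV * L ^ 2 / β ^ 2) * (C10 / β ^ 5))) := by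
    calc gaussAvg β H (fun a => (linCurvSq H p₀ a - m) ^ 2 * cubicVertex β H a ^ 2)
        ≤ gaussAvg β H (fun a => 2 * (ct a ^ 2 * (β * ∑ p ∈ PT, P p a) ^ 2) +
            2 * β ^ 2 * PT.card * (C8 ^ 2 * 4 ^ 9 * 81) * (ct a ^ 2 * ∑ p ∈ PT, ∑ i : Fin 4, ∑ e : LandauFree H, ∑ c : Fin 3, D p i e c a)) :=
          gaussAvg_mono_of_nonneg H hβ (fun a => mul_nonneg (sq_nonneg _) (sq_nonneg _)) hdom hIG
      _ = 2 * gaussAvg β H (fun a => ct a ^ 2 * (β * ∑ p ∈ PT, P p a) ^ 2) +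
            2 * β ^ 2 * PT.card * (C8 ^ 2 * 4 ^ 9 * 81) *
              gaussAvg β H (fun a => ct a ^ 2 * ∑ p ∈ PT, ∑ i : Fin 4, ∑ e : LandauFree H, ∑ c : Fin 3, D p i e c a) := by
          have hI1' : Integrable (fun a : LandauFree H → E3 => 2 * (ct a ^ 2 * (β * ∑ p ∈ PT, P p a) ^ 2) * gaussWeight β H a) :=
            (hI1.const_mul 2).congr (Filter.Eventually.of_forall fun a => by ring)
          have hIS' : Integrable (fun a : LandauFree H → E3 => 2 * β ^ 2 * PT.card * (C8 ^ 2 * 4 ^ 9 * 81) *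
              (ct a ^ 2 * ∑ p ∈ PT, ∑ i : Fin 4, ∑ e : LandauFree H, ∑ c : Fin 3, D p i e c a) * gaussWeight β H a) :=
            (hIS.const_mul (2 * β ^ 2 * PT.card * (C8 ^ 2 * 4 ^ 9 * 81))).congr (Filter.Eventually.of_forall fun a => by ring)
          rw [gaussAvg_add _ _ hI1' hIS', gaussAvg_const_mul, gaussAvg_const_mul]
      _ ≤ _ := add_le_add (mul_le_mul_of_nonneg_left hA (by norm_num)) (mul_le_mul_of_nonneg_left hBsum (by positivity))
  refine hmain.trans ?_
  -- numeric bookkeeping: term A `= 486·CV·CTB·C7²·H⁴L⁵/β³`, term B `= KB·#PT²·L²/β⁵ ≤ KB·2²⁴·H⁴L⁵/β³`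
  have hTA : 2 * (243 * (CV * L ^ 2 / β ^ 2) * (CTB * C7 ^ 2 * (H : ℝ) ^ 4 * L ^ 3 / β)) =
      486 * CV * CTB * C7 ^ 2 * ((H : ℝ) ^ 4 * L ^ 5 / β ^ 3) := by
    field_simp
    ring
  have hTB2 : 2 * β ^ 2 * PT.card * (C8 ^ 2 * 4 ^ 9 * 81) * (4 * PT.card * (3 ^ 8 * (CV * L ^ 2 / β ^ 2) * (C10 / β ^ 5))) =
      KB * ((PT.card : ℝ) ^ 2 * L ^ 2 / β ^ 5) := by
    have h1 : β ^ 2 * (CV * L ^ 2 / β ^ 2) = CV * L ^ 2 := by field_simp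
    calc 2 * β ^ 2 * PT.card * (C8 ^ 2 * 4 ^ 9 * 81) * (4 * PT.card * (3 ^ 8 * (CV * L ^ 2 / β ^ 2) * (C10 / β ^ 5)))
        = (2 * 81 * 4 * 3 ^ 8 * (C8 ^ 2 * 4 ^ 9)) * (β ^ 2 * (CV * L ^ 2 / β ^ 2)) * (C10 / β ^ 5) * (PT.card : ℝ) ^ 2 := by ring
      _ = KB * ((PT.card : ℝ) ^ 2 * L ^ 2 / β ^ 5) := by rw [h1, hKB]; ring
  have hstep : (PT.card : ℝ) ^ 2 * L ^ 2 / β ^ 5 ≤ 2 ^ 24 * ((H : ℝ) ^ 4 * L ^ 5 / β ^ 3) := by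
    have hL25 : L ^ 2 ≤ L ^ 5 := pow_le_pow_right₀ hL1 (by norm_num)
    have hL2 : 0 ≤ L ^ 2 := by positivity
    calc (PT.card : ℝ) ^ 2 * L ^ 2 / β ^ 5 ≤ 2 ^ 24 * (H : ℝ) ^ 8 * L ^ 2 / β ^ 5 :=
          div_le_div_of_nonneg_right (mul_le_mul_of_nonneg_right hPT2 hL2) (by positivity)
      _ = 2 ^ 24 * ((H : ℝ) ^ 4 / β ^ 2) * ((H : ℝ) ^ 4 * L ^ 2 / β ^ 3) := by field_simp
      _ ≤ 2 ^ 24 * 1 * ((H : ℝ) ^ 4 * L ^ 5 / β ^ 3) := by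
          refine mul_le_mul (mul_le_mul_of_nonneg_left ((div_le_one (by positivity)).2 hH4β) (by norm_num)) ?_ (by positivity) (by norm_num)
          exact div_le_div_of_nonneg_right (mul_le_mul_of_nonneg_left hL25 (by positivity)) (by positivity)
      _ = 2 ^ 24 * ((H : ℝ) ^ 4 * L ^ 5 / β ^ 3) := by ring
  have hKB0 : 0 ≤ KB := by rw [hKB]; positivity
  rw [hTA, hTB2]
  calc 486 * CV * CTB * C7 ^ 2 * ((H : ℝ) ^ 4 * L ^ 5 / β ^ 3) + KB * ((PT.card : ℝ) ^ 2 * L ^ 2 / β ^ 5)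
      ≤ 486 * CV * CTB * C7 ^ 2 * ((H : ℝ) ^ 4 * L ^ 5 / β ^ 3) + KB * (2 ^ 24 * ((H : ℝ) ^ 4 * L ^ 5 / β ^ 3)) :=
        add_le_add le_rfl (mul_le_mul_of_nonneg_left hstep hKB0)
    _ = (486 * CV * CTB * C7 ^ 2 + KB * 2 ^ 24) * (1 + Real.log H) ^ 5 * (H : ℝ) ^ 4 / β ^ 3 := by rw [hL]; ring

end EdgeChartGaussian

/-- ★★ **T-S5.10 by name, modulo T-S5.7a**: `WilsonPlaquetteTaylor → CubicDecorrelation`. -/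
theorem cubicDecorrelation_of_wilsonPlaquetteTaylor (h7a : WilsonPlaquetteTaylor) : CubicDecorrelation :=
  EdgeChartGaussian.cubicDecorrelation_of h7a

end Summit.QuantumFields.YangMills.Theorems.AllWindowsColdBoxBoxHighLine

end
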